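import Literature.Geometry.Riemannian.GeneralizedCylinderMeanCurvature
import Literature.Geometry.Riemannian.RoundSphere
import Literature.Geometry.Lorentzian.PseudoRiemannianMetricProofs
import Literature.Geometry.Lorentzian.HypersurfaceNaturality
import Mathlib.Analysis.Calculus.BumpFunction.Basic
import Mathlib.Analysis.Calculus.BumpFunction.InnerProduct
import HarnessLib

/-!
# Conformally deforming the slices of a generalized cylinder (Bär–Hanke 2023, §3, Prop. 28)

Topic `Literature/Geometry/Riemannian`. A brick of the proof of the named fact
`Literature.Geometry.Riemannian.BarHanke2023_prop28_meanCurvatureIncrease`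
(`BaerHankeNormalForm.lean`; Bär–Hanke, *Boundary conditions for scalar curvature*, §3,
Prop. 28: the mean curvature of the boundary can be raised keeping the boundary metric and
`scal > σ`). In boundary normal coordinates the metric is a generalized cylinder
`G = g_t + dt²` on `∂M × [0, ε)` (§3, (7)–(8)) and Bär–Hanke deform the family `g_t` near `t = 0`
(printed deformation: `g_t - sδψ(t) g_0`; `II_{f(s)} = II_g + ½ sδ g_0`). We use the conformal
variant `g_t ↦ f(z, t) · g_t` with a positive factor `f` (`f = e^{-δψ(t)}` downstream), which has
the same first-order effect at `t = 0` and stays Riemannian for every value of the parameter: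

* `exists_linearCutoff` — a smooth `ψ : ℝ → ℝ` with `ψ(t) = t` for `|t| ≤ r/2` and `ψ(t) = 0`
  for `|t| ≥ r` (Bär–Hanke's cut-off "`ψ(t) = t` near `0`, `ψ(t) = 0` for `t ≥ ε`");
* `exists_cylDeform` — for a Riemannian cylinder metric `G` on `N × ℝ` and a positive `C^∞`
  function `f` there is a Riemannian `C^∞` metric `Γ` with the cylinder property and values
  `Γ_p(v, w) = f(p) G_p(v, w) + (1 - f(p)) v₂ w₂`, i.e. `Γ = f · g_t + dt²` (the field `dt²` is
  the pullback of the Euclidean metric of `ℝ` along `N × ℝ → ℝ`, a `C^∞` section);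
* `two_mul_secondFundamentalForm_cylSlice_of_val` — for any such `Γ` the slices have second
  fundamental form `K^Γ_t = f K_t + ½ ḟ g_t` (`ġ = 2K`, `hasDerivAt_cyl_val_two_mul`, for both
  metrics);
* `meanCurvature_cylSlice_of_val` — hence, at a slice where `f = 1`, `H^Γ_t = H_t + ½ ḟ · dim N`
  (Bär–Hanke: `H_{f(s)} = H_g + ½ sδ`, up to their normalisation `1/(n-1)` and sign conventions).

Everything is proved; no definitions, no named facts (D-0026).

## References

* C. Bär, B. Hanke, *Boundary conditions for scalar curvature*, arXiv:2012.09127, §3, (7)–(8)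
  and Prop. 28 with its proof (p. 13). [BarHanke2023]
* B. O'Neill, *Semi-Riemannian geometry* (1983), Ch. 3, pp. 60–61; Ch. 4, Lemma 4.4.
  [ONeill1983]
-/

noncomputable section

open Bundle Set Filter Function Metric
open scoped Manifold ContDiff Topology RealInnerProductSpace

namespace Literature.Geometry.Riemannian

open Literature.Geometry.Lorentzian
open Literature.Geometry.Lorentzian.PseudoRiemannianMetric

/-! ### A linear cut-off -/

/-- **Bär–Hanke's cut-off** (proof of Prop. 28: "let `ψ` be a smooth function with `ψ(t) = t`
for `t` near `0` and `ψ(t) = 0` for `t ≥ ε`"), two-sided version on `ℝ`: for `r > 0` there is a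
`C^∞` function `ψ` with `ψ(t) = t` for `|t| ≤ r/2` and `ψ(t) = 0` for `|t| ≥ r`
(`ψ(t) = t · χ(t)` for a smooth bump `χ`). [cite: BarHanke2023, §3, proof of Prop. 28] -/
theorem exists_linearCutoff {r : ℝ} (hr : 0 < r) :
    ∃ ψ : ℝ → ℝ, ContDiff ℝ ∞ ψ ∧ (∀ t, |t| ≤ r / 2 → ψ t = t) ∧ (∀ t, r ≤ |t| → ψ t = 0) := by
  set χ : ContDiffBump (0 : ℝ) := ⟨r / 2, r, by linarith, by linarith⟩ with hχ
  refine ⟨fun t ↦ t * χ t, contDiff_id.mul χ.contDiff, fun t ht ↦ ?_, fun t ht ↦ ?_⟩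
  · have h1 : (χ : ℝ → ℝ) t = 1 := χ.one_of_mem_closedBall (by simpa using ht)
    simp [h1]
  · have h0 : (χ : ℝ → ℝ) t = 0 := χ.zero_of_le_dist (by simpa using ht)
    simp [h0]

variable {E' : Type*} [NormedAddCommGroup E'] [NormedSpace ℝ E'] [FiniteDimensional ℝ E']
  {H' : Type*} [TopologicalSpace H'] {I' : ModelWithCorners ℝ E' H'} [I'.Boundaryless]
  {N : Type*} [TopologicalSpace N] [ChartedSpace H' N] [IsManifold I' ∞ N]

/-! ### Horizontal values of a Riemannian metric on `N × ℝ` -/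

variable (G : PseudoRiemannianMetric (I'.prod 𝓘(ℝ, ℝ)) ∞ (E' × ℝ)
    (TangentSpace (I'.prod 𝓘(ℝ, ℝ)) : N × ℝ → Type _))

omit [FiniteDimensional ℝ E'] [I'.Boundaryless] in
/-- `G((u,0),(u,0)) ≥ 0` for a Riemannian `G`. [folklore] -/
theorem cyl_val_hor_self_nonneg (hG : G.IsRiemannian) (p : N × ℝ) (u : E') :
    0 ≤ G.val p ((u, 0) : TangentSpace (I'.prod 𝓘(ℝ, ℝ)) p)
      ((u, 0) : TangentSpace (I'.prod 𝓘(ℝ, ℝ)) p) := by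
  by_cases hu : u = 0
  · rw [hu]
    exact (cyl_val_mk_zero_left G p _).ge
  · refine (hG p _ fun h ↦ hu ?_).le
    exact congrArg Prod.fst h

omit [FiniteDimensional ℝ E'] [I'.Boundaryless] in
/-- `G((u,0),(u,0)) > 0` for `u ≠ 0` and a Riemannian `G`. [folklore] -/
theorem cyl_val_hor_self_pos (hG : G.IsRiemannian) (p : N × ℝ) {u : E'} (hu : u ≠ 0) :
    0 < G.val p ((u, 0) : TangentSpace (I'.prod 𝓘(ℝ, ℝ)) p)
      ((u, 0) : TangentSpace (I'.prod 𝓘(ℝ, ℝ)) p) := by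
  refine hG p _ fun h ↦ hu ?_
  exact congrArg Prod.fst h

/-! ### The deformed cylinder metric `f · g_t + dt²` -/

omit [FiniteDimensional ℝ E'] [I'.Boundaryless] in
set_option synthInstance.maxHeartbeats 400000 in
set_option maxHeartbeats 1600000 in
/-- **The conformally deformed generalized cylinder** `f · g_t + dt²` (existence as a smooth
metric). For a Riemannian metric `G` on `N × ℝ` with the cylinder property
`G((v,a),(w,b)) = G((v,0),(w,0)) + ab` and a positive `C^∞` function `f` on `N × ℝ` there is a
Riemannian `C^∞` metric `Γ` on `N × ℝ` with the cylinder property and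
`Γ_p(v, w) = f(p) G_p(v, w) + (1 - f(p)) v₂ w₂ (= f(p) g_t(v₁, w₁) + v₂ w₂)`. Construction:
`Γ = f • G + (1 - f) • dt²` with `dt²` the pullback of the Euclidean metric of `ℝ` along the
projection `N × ℝ → ℝ` (a `C^∞` section: `contMDiff_pullbackBilin_holds`; sums and smooth
multiples of smooth sections). Bär–Hanke deform `g_t` additively (`g_t - sδψ(t) g_0`, proof of
Prop. 28); the conformal variant has the same first-order effect at the boundary slice
(`meanCurvature_cylSlice_of_val`) and is Riemannian for every `f > 0`.
[cite: BarHanke2023, §3, (7) and proof of Prop. 28] -/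
theorem exists_cylDeform (hG : G.IsRiemannian)
    (hcyl : ∀ (p : N × ℝ) (v w : TangentSpace (I'.prod 𝓘(ℝ, ℝ)) p),
      G.val p v w = G.val p ((v.1, 0) : TangentSpace (I'.prod 𝓘(ℝ, ℝ)) p)
        ((w.1, 0) : TangentSpace (I'.prod 𝓘(ℝ, ℝ)) p) + v.2 * w.2)
    (f : N × ℝ → ℝ) (hf : ContMDiff (I'.prod 𝓘(ℝ, ℝ)) 𝓘(ℝ, ℝ) ∞ f) (hpos : ∀ p, 0 < f p) :
    ∃ Γ : PseudoRiemannianMetric (I'.prod 𝓘(ℝ, ℝ)) ∞ (E' × ℝ)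
        (TangentSpace (I'.prod 𝓘(ℝ, ℝ)) : N × ℝ → Type _),
      Γ.IsRiemannian ∧
      (∀ (p : N × ℝ) (v w : TangentSpace (I'.prod 𝓘(ℝ, ℝ)) p),
        Γ.val p v w = Γ.val p ((v.1, 0) : TangentSpace (I'.prod 𝓘(ℝ, ℝ)) p)
          ((w.1, 0) : TangentSpace (I'.prod 𝓘(ℝ, ℝ)) p) + v.2 * w.2) ∧
      ∀ (p : N × ℝ) (v w : TangentSpace (I'.prod 𝓘(ℝ, ℝ)) p),
        Γ.val p v w = f p * G.val p v w + (1 - f p) * (v.2 * w.2) := by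
  -- the field `dt²`
  set D : Π p : N × ℝ, TangentSpace (I'.prod 𝓘(ℝ, ℝ)) p →L[ℝ]
      TangentSpace (I'.prod 𝓘(ℝ, ℝ)) p →L[ℝ] ℝ :=
    pullbackBilin (I := 𝓘(ℝ, ℝ)) (I' := I'.prod 𝓘(ℝ, ℝ)) (Prod.snd : N × ℝ → ℝ)
      (euclideanMetric ℝ).val with hD
  have hDapply : ∀ (p : N × ℝ) (v w : TangentSpace (I'.prod 𝓘(ℝ, ℝ)) p), D p v w = v.2 * w.2 := by
    intro p v w
    rw [hD, pullbackBilin_apply, euclideanMetric_apply, mfderiv_snd]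
    show ⟪v.2, w.2⟫ = v.2 * w.2
    rw [real_inner_comm]
    rfl
  have hDs : ContMDiff (I'.prod 𝓘(ℝ, ℝ))
      ((I'.prod 𝓘(ℝ, ℝ)).prod 𝓘(ℝ, (E' × ℝ) →L[ℝ] (E' × ℝ) →L[ℝ] ℝ)) ∞
      (fun q : N × ℝ ↦ TotalSpace.mk' ((E' × ℝ) →L[ℝ] (E' × ℝ) →L[ℝ] ℝ)
        (E := fun q : N × ℝ ↦ TangentSpace (I'.prod 𝓘(ℝ, ℝ)) q →L[ℝ]
          TangentSpace (I'.prod 𝓘(ℝ, ℝ)) q →L[ℝ] ℝ) q (D q)) :=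
    contMDiff_pullbackBilin_holds (I := 𝓘(ℝ, ℝ)) (M := ℝ) (I' := I'.prod 𝓘(ℝ, ℝ)) (N := N × ℝ)
      Prod.snd contMDiff_snd (euclideanMetric ℝ)
  -- the field `f • G + (1 - f) • dt²`
  set val : Π p : N × ℝ, TangentSpace (I'.prod 𝓘(ℝ, ℝ)) p →L[ℝ]
      TangentSpace (I'.prod 𝓘(ℝ, ℝ)) p →L[ℝ] ℝ := fun p ↦ f p • G.val p + (1 - f p) • D p
    with hval
  have hvapply : ∀ (p : N × ℝ) (v w : TangentSpace (I'.prod 𝓘(ℝ, ℝ)) p),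
      val p v w = f p * G.val p v w + (1 - f p) * (v.2 * w.2) := fun p v w ↦ by
    simp only [hval, _root_.add_apply, _root_.smul_apply, smul_eq_mul, hDapply]
  -- smoothness
  have hsmooth : ContMDiff (I'.prod 𝓘(ℝ, ℝ))
      ((I'.prod 𝓘(ℝ, ℝ)).prod 𝓘(ℝ, (E' × ℝ) →L[ℝ] (E' × ℝ) →L[ℝ] ℝ)) ∞
      (fun q : N × ℝ ↦ TotalSpace.mk' ((E' × ℝ) →L[ℝ] (E' × ℝ) →L[ℝ] ℝ)
        (E := fun q : N × ℝ ↦ TangentSpace (I'.prod 𝓘(ℝ, ℝ)) q →L[ℝ]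
          TangentSpace (I'.prod 𝓘(ℝ, ℝ)) q →L[ℝ] ℝ) q (val q)) := by
    intro p
    have h1 : ContMDiffAt (I'.prod 𝓘(ℝ, ℝ))
        ((I'.prod 𝓘(ℝ, ℝ)).prod 𝓘(ℝ, (E' × ℝ) →L[ℝ] (E' × ℝ) →L[ℝ] ℝ)) ∞
        (fun q : N × ℝ ↦ TotalSpace.mk' ((E' × ℝ) →L[ℝ] (E' × ℝ) →L[ℝ] ℝ)
          (E := fun q : N × ℝ ↦ TangentSpace (I'.prod 𝓘(ℝ, ℝ)) q →L[ℝ]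
            TangentSpace (I'.prod 𝓘(ℝ, ℝ)) q →L[ℝ] ℝ) q ((f • G.val) q)) p :=
      (hf p).smul_section (G.contMDiff p)
    have h2 : ContMDiffAt (I'.prod 𝓘(ℝ, ℝ))
        ((I'.prod 𝓘(ℝ, ℝ)).prod 𝓘(ℝ, (E' × ℝ) →L[ℝ] (E' × ℝ) →L[ℝ] ℝ)) ∞
        (fun q : N × ℝ ↦ TotalSpace.mk' ((E' × ℝ) →L[ℝ] (E' × ℝ) →L[ℝ] ℝ)
          (E := fun q : N × ℝ ↦ TangentSpace (I'.prod 𝓘(ℝ, ℝ)) q →L[ℝ]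
            TangentSpace (I'.prod 𝓘(ℝ, ℝ)) q →L[ℝ] ℝ) q (((fun q ↦ 1 - f q) • D) q)) p :=
      (contMDiffAt_const.sub (hf p)).smul_section (hDs p)
    exact h1.add_section h2
  -- positivity: `val p v v = f G((v₁,0),(v₁,0)) + v₂² > 0` for `v ≠ 0`
  have hvpos : ∀ (p : N × ℝ) (v : TangentSpace (I'.prod 𝓘(ℝ, ℝ)) p), v ≠ 0 → 0 < val p v v := by
    intro p v hv
    rw [hvapply, hcyl p v v]
    have hh := cyl_val_hor_self_nonneg G hG p v.1
    by_cases h2 : v.2 = 0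
    · have hv1 : v.1 ≠ 0 := fun h0 ↦ hv (Prod.ext h0 h2)
      have h3 : 0 < G.val p ((v.1, 0) : TangentSpace (I'.prod 𝓘(ℝ, ℝ)) p)
          ((v.1, 0) : TangentSpace (I'.prod 𝓘(ℝ, ℝ)) p) := cyl_val_hor_self_pos G hG p hv1
      have h4 : 0 < f p * G.val p ((v.1, 0) : TangentSpace (I'.prod 𝓘(ℝ, ℝ)) p)
          ((v.1, 0) : TangentSpace (I'.prod 𝓘(ℝ, ℝ)) p) := mul_pos (hpos p) h3
      rw [h2, mul_zero, add_zero, mul_zero, add_zero]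
      exact h4
    · have h2' : 0 < v.2 * v.2 := mul_self_pos.2 h2
      have h4 : 0 ≤ f p * G.val p ((v.1, 0) : TangentSpace (I'.prod 𝓘(ℝ, ℝ)) p)
          ((v.1, 0) : TangentSpace (I'.prod 𝓘(ℝ, ℝ)) p) := mul_nonneg (hpos p).le hh
      nlinarith [hpos p]
  refine ⟨⟨val, ?_, ?_, hsmooth⟩, fun p v hv ↦ hvpos p v hv, ?_, hvapply⟩
  · -- symmetry
    intro p v w
    rw [hvapply, hvapply, G.symm p v w, mul_comm v.2 w.2]
  · -- nondegeneracy
    intro p v hv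
    by_contra hne
    exact (hvpos p v hne).ne' (hv v)
  · -- cylinder property
    intro p v w
    show val p v w = val p _ _ + v.2 * w.2
    rw [hvapply, hvapply, hcyl p v w]
    show _ = f p * G.val p ((v.1, 0) : TangentSpace (I'.prod 𝓘(ℝ, ℝ)) p)
      ((w.1, 0) : TangentSpace (I'.prod 𝓘(ℝ, ℝ)) p) + (1 - f p) * ((0 : ℝ) * 0) + v.2 * w.2
    ring

/-! ### Second fundamental form and mean curvature of the slices of `f · g_t + dt²` -/

section Slices

variable (Γ : PseudoRiemannianMetric (I'.prod 𝓘(ℝ, ℝ)) ∞ (E' × ℝ)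
    (TangentSpace (I'.prod 𝓘(ℝ, ℝ)) : N × ℝ → Type _))
  (hG : G.IsRiemannian) (hΓ : Γ.IsRiemannian)
  (hcyl : ∀ (p : N × ℝ) (v w : TangentSpace (I'.prod 𝓘(ℝ, ℝ)) p),
    G.val p v w = G.val p ((v.1, 0) : TangentSpace (I'.prod 𝓘(ℝ, ℝ)) p)
      ((w.1, 0) : TangentSpace (I'.prod 𝓘(ℝ, ℝ)) p) + v.2 * w.2)
  (hΓcyl : ∀ (p : N × ℝ) (v w : TangentSpace (I'.prod 𝓘(ℝ, ℝ)) p),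
    Γ.val p v w = Γ.val p ((v.1, 0) : TangentSpace (I'.prod 𝓘(ℝ, ℝ)) p)
      ((w.1, 0) : TangentSpace (I'.prod 𝓘(ℝ, ℝ)) p) + v.2 * w.2)
  (f : N × ℝ → ℝ)
  (hΓval : ∀ (p : N × ℝ) (v w : TangentSpace (I'.prod 𝓘(ℝ, ℝ)) p),
    Γ.val p v w = f p * G.val p v w + (1 - f p) * (v.2 * w.2))

omit [FiniteDimensional ℝ E'] [I'.Boundaryless] in
include hΓval in
/-- On horizontal vectors `Γ = f · g_t + dt²` is `f · g_t`: `Γ((v,0),(w,0)) = f(p) G((v,0),(w,0))`.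
[folklore] -/
theorem val_hor_of_val (p : N × ℝ) (v w : E') :
    Γ.val p ((v, 0) : TangentSpace (I'.prod 𝓘(ℝ, ℝ)) p) ((w, 0) : TangentSpace (I'.prod 𝓘(ℝ, ℝ)) p) =
      f p * G.val p ((v, 0) : TangentSpace (I'.prod 𝓘(ℝ, ℝ)) p)
        ((w, 0) : TangentSpace (I'.prod 𝓘(ℝ, ℝ)) p) := by
  rw [hΓval]
  show _ + (1 - f p) * ((0 : ℝ) * 0) = _
  ring

omit [FiniteDimensional ℝ E'] [I'.Boundaryless] in
include hΓval in
/-- Where `f = 1` the deformed metric is the original one. [folklore] -/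
theorem val_eq_of_val_of_eq_one {p : N × ℝ} (h1 : f p = 1) : Γ.val p = G.val p := by
  refine ContinuousLinearMap.ext fun v ↦ ContinuousLinearMap.ext fun w ↦ ?_
  rw [hΓval, h1]
  ring

omit [I'.Boundaryless] in
/-- The slice-`t` induced metric of a metric on `N × ℝ` evaluated: `g_t(v, w) = G((v,0),(w,0))`.
[folklore] -/
theorem inducedMetric_cylSlice_apply (z : N) (t : ℝ) (v w : TangentSpace I' z) :
    (G.inducedMetric (fun y : N ↦ ((y, t) : N × ℝ))
        (contMDiff_pullbackBilin_holds (I := I'.prod 𝓘(ℝ, ℝ)) (M := N × ℝ) (I' := I') (N := N))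
        (isSpacelikeImmersion_cylSlice G hG t)).val z v w =
      G.val (z, t) ((v, 0) : TangentSpace (I'.prod 𝓘(ℝ, ℝ)) (z, t))
        ((w, 0) : TangentSpace (I'.prod 𝓘(ℝ, ℝ)) (z, t)) := by
  rw [inducedMetric_val, inducedBilin_apply, mfderiv_cylSlice_apply, mfderiv_cylSlice_apply]

omit [I'.Boundaryless] in
include hΓval in
/-- The slice-`t` induced metrics of `Γ = f·g_t + dt²` and `G` coincide where `f = 1`.
[folklore] -/
theorem inducedMetric_cylSlice_val_eq_of_val {z : N} {t : ℝ} (h1 : f (z, t) = 1) :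
    (Γ.inducedMetric (fun y : N ↦ ((y, t) : N × ℝ))
        (contMDiff_pullbackBilin_holds (I := I'.prod 𝓘(ℝ, ℝ)) (M := N × ℝ) (I' := I') (N := N))
        (isSpacelikeImmersion_cylSlice Γ hΓ t)).val z =
      (G.inducedMetric (fun y : N ↦ ((y, t) : N × ℝ))
        (contMDiff_pullbackBilin_holds (I := I'.prod 𝓘(ℝ, ℝ)) (M := N × ℝ) (I' := I') (N := N))
        (isSpacelikeImmersion_cylSlice G hG t)).val z := by
  refine ContinuousLinearMap.ext fun v ↦ ContinuousLinearMap.ext fun w ↦ ?_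
  rw [inducedMetric_cylSlice_apply Γ hΓ, inducedMetric_cylSlice_apply G hG,
    val_eq_of_val_of_eq_one G Γ f hΓval h1]

variable [G.HasLeviCivita] [Γ.HasLeviCivita]

include hcyl hΓcyl hΓval in
/-- **`K^Γ_t = f K_t + ½ ḟ g_t`**: the second fundamental forms (w.r.t. `∂_t`) of the slice `t`
of `Γ = f · g_t + dt²` and of `G = g_t + dt²` are related by
`2 K^Γ_t(v, w) = ḟ g_t(v, w) + f · 2 K_t(v, w)`, where `ḟ` is the `t`-derivative of `f(z, ·)`
(both sides are `∂_t` of the slice coefficients, `hasDerivAt_cyl_val_two_mul`; Bär–Hanke (8):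
`II_t = -½ ġ_t`). [cite: BarHanke2023, §3, (8) and proof of Prop. 28] -/
theorem two_mul_secondFundamentalForm_cylSlice_of_val
    (z : N) (t : ℝ) {f' : ℝ} (hft : HasDerivAt (fun τ ↦ f (z, τ)) f' t) (v w : E') :
    2 * Γ.secondFundamentalForm I' (fun y : N ↦ ((y, t) : N × ℝ))
        (fun y ↦ velocity (I'.prod 𝓘(ℝ, ℝ)) (fun s : ℝ ↦ ((y, s) : N × ℝ)) t) z v w =
      f' * G.val (z, t) ((v, 0) : TangentSpace (I'.prod 𝓘(ℝ, ℝ)) (z, t))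
          ((w, 0) : TangentSpace (I'.prod 𝓘(ℝ, ℝ)) (z, t)) +
        f (z, t) * (2 * G.secondFundamentalForm I' (fun y : N ↦ ((y, t) : N × ℝ))
          (fun y ↦ velocity (I'.prod 𝓘(ℝ, ℝ)) (fun s : ℝ ↦ ((y, s) : N × ℝ)) t) z v w) := by
  have h1 := hasDerivAt_cyl_val_two_mul Γ hΓcyl z t v w
  have h2 : HasDerivAt (fun τ ↦ f (z, τ) * G.val (z, τ)
      ((v, 0) : TangentSpace (I'.prod 𝓘(ℝ, ℝ)) (z, τ))
      ((w, 0) : TangentSpace (I'.prod 𝓘(ℝ, ℝ)) (z, τ)))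
      (f' * G.val (z, t) ((v, 0) : TangentSpace (I'.prod 𝓘(ℝ, ℝ)) (z, t))
          ((w, 0) : TangentSpace (I'.prod 𝓘(ℝ, ℝ)) (z, t)) +
        f (z, t) * (2 * G.secondFundamentalForm I' (fun y : N ↦ ((y, t) : N × ℝ))
          (fun y ↦ velocity (I'.prod 𝓘(ℝ, ℝ)) (fun s : ℝ ↦ ((y, s) : N × ℝ)) t) z v w)) t :=
    hft.mul (hasDerivAt_cyl_val_two_mul G hcyl z t v w)
  have h1' : HasDerivAt (fun τ ↦ f (z, τ) * G.val (z, τ)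
      ((v, 0) : TangentSpace (I'.prod 𝓘(ℝ, ℝ)) (z, τ))
      ((w, 0) : TangentSpace (I'.prod 𝓘(ℝ, ℝ)) (z, τ)))
      (2 * Γ.secondFundamentalForm I' (fun y : N ↦ ((y, t) : N × ℝ))
        (fun y ↦ velocity (I'.prod 𝓘(ℝ, ℝ)) (fun s : ℝ ↦ ((y, s) : N × ℝ)) t) z v w) t := by
    refine h1.congr_of_eventuallyEq (Eventually.of_forall fun τ ↦ ?_)
    exact (val_hor_of_val G Γ f hΓval (z, τ) v w).symm
  exact h1'.unique h2

include hcyl hΓcyl hΓval in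
/-- **The mean curvature of the slices of `f · g_t + dt²` where `f = 1`**: if `f(z, t) = 1` and
`ḟ = f'` at `(z, t)`, then `H^Γ_t(z) = H_t(z) + ½ f' · dim N` (`K^Γ_t = K_t + ½ f' g_t` and
`tr_{g_t} g_t = dim N`). With `f = e^{-δψ}`, `ψ(0) = 0`, `ψ'(0) = 1` this is Bär–Hanke's
`H_{f(s)} = H_g + ½ sδ` at the boundary slice (their `H = (1/(n-1)) tr II` w.r.t. the interior
normal; the tree's `H` is the full trace w.r.t. `∂_t`). [cite: BarHanke2023, §3, proof of Prop. 28] -/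
theorem meanCurvature_cylSlice_of_val
    {z : N} {t : ℝ} (h1 : f (z, t) = 1) {f' : ℝ} (hft : HasDerivAt (fun τ ↦ f (z, τ)) f' t) :
    Γ.meanCurvature (fun y : N ↦ ((y, t) : N × ℝ))
        (contMDiff_pullbackBilin_holds (I := I'.prod 𝓘(ℝ, ℝ)) (M := N × ℝ) (I' := I') (N := N))
        (isSpacelikeImmersion_cylSlice Γ hΓ t)
        (fun y ↦ velocity (I'.prod 𝓘(ℝ, ℝ)) (fun s : ℝ ↦ ((y, s) : N × ℝ)) t) z =
      G.meanCurvature (fun y : N ↦ ((y, t) : N × ℝ))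
        (contMDiff_pullbackBilin_holds (I := I'.prod 𝓘(ℝ, ℝ)) (M := N × ℝ) (I' := I') (N := N))
        (isSpacelikeImmersion_cylSlice G hG t)
        (fun y ↦ velocity (I'.prod 𝓘(ℝ, ℝ)) (fun s : ℝ ↦ ((y, s) : N × ℝ)) t) z +
      f' / 2 * Module.finrank ℝ E' := by
  set hpb := contMDiff_pullbackBilin_holds (I := I'.prod 𝓘(ℝ, ℝ)) (M := N × ℝ) (I' := I') (N := N)
    (n := (∞ : ℕ∞ω)) with hpb_def
  set gN := G.inducedMetric (fun y : N ↦ ((y, t) : N × ℝ)) hpb (isSpacelikeImmersion_cylSlice G hG t)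
    with hgN
  set KΓ := Γ.secondFundamentalForm I' (fun y : N ↦ ((y, t) : N × ℝ))
    (fun y ↦ velocity (I'.prod 𝓘(ℝ, ℝ)) (fun s : ℝ ↦ ((y, s) : N × ℝ)) t) z with hKΓ
  set K := G.secondFundamentalForm I' (fun y : N ↦ ((y, t) : N × ℝ))
    (fun y ↦ velocity (I'.prod 𝓘(ℝ, ℝ)) (fun s : ℝ ↦ ((y, s) : N × ℝ)) t) z with hK
  -- `K^Γ = K + (f'/2) g_t`
  have hKeq : KΓ = K + (f' / 2) • gN.toBilinForm z := by
    refine LinearMap.ext fun v ↦ LinearMap.ext fun w ↦ ?_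
    have h := two_mul_secondFundamentalForm_cylSlice_of_val G Γ hcyl hΓcyl f hΓval z t hft v w
    rw [h1, one_mul] at h
    rw [LinearMap.add_apply, LinearMap.add_apply, LinearMap.smul_apply, LinearMap.smul_apply,
      toBilinForm_apply, hgN, inducedMetric_cylSlice_apply G hG z t v w, smul_eq_mul]
    change KΓ v w = K v w + _
    linarith
  have hlin : gN.trace z (K + (f' / 2) • gN.toBilinForm z) =
      gN.trace z K + (f' / 2) * gN.trace z (gN.toBilinForm z) := by
    simp only [PseudoRiemannianMetric.trace, LinearMap.comp_add, LinearMap.comp_smul, map_add,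
      map_smul, smul_eq_mul]
  unfold meanCurvature
  rw [trace_congr (inducedMetric_cylSlice_val_eq_of_val G Γ hG hΓ f hΓval h1) _]
  change gN.trace z KΓ = gN.trace z K + _
  rw [hKeq, hlin, trace_toBilinForm_eq]

end Slices

end Literature.Geometry.Riemannian
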